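import Summits.CriticalPhenomena.PercolationContinuityZ3.Theorems.PercNearOneGluingNoHeavyLowerTailSahiUniformGrid

/-!
# `NoHeavyLowerTail` (crux stmt-CriticalPhenomena-4575), Sahi programme P1: the open small lattices sit in layer three

Support file (Sahi cell, seat `prim-sahi-p1`, generation 3; `--supports stmt-CriticalPhenomena-4575`).

The three smallest finite distributive lattices on which Sahi's Conjecture 5 is not yet a theorem of the tree —
`[2]×[2]×[3]` (12 elements), `V+pt = WithBot(2²)×2` and `Λ+pt = WithTop(2²)×2` (10 elements each; certified by exact
FKG-minor certificates only) — all embed as sublattices into the box `[3]³`.  Hence, by the width stratification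
(`SahiWidth.fkg_grid_iff_uniform`, `sahiPositive_of_latticeEmbedding_grid`), EACH of them is settled at order `n` as soon
as the UNIFORM weight on every box `[M]³` is Sahi-positive at order `n` (Lieb–Sahi's Conjecture 1.1 for `[0,1]³`,
discretised; OPEN — taken as a hypothesis, nothing is asserted).  The lattice embeddings are explicit vectors in `[3]³`,
checked by `decide`.
-/

namespace Summit.CriticalPhenomena.PercolationContinuityZ3.Theorems.SahiWidth

open Finset Function Literature.Combinatorics.Sahi2008
open scoped BigOperators

noncomputable section

variable {n : ℕ}

/-- Layer three from the uniform boxes: under `U(3,n)`, every FKG weight on a lattice with a lattice embedding into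
`[3]³ = (Fin 3 → Fin 3)` is Sahi-positive at order `n`. [this work] -/
theorem sahiPositive_of_embedding_box3 (hU : ∀ M, 0 < M → SahiPositive (fun _ : Fin 3 → Fin M => (1 : ℝ) / (M : ℝ) ^ 3) n)
    {L : Type*} [DistribLattice L] [Fintype L] [DecidableEq L] (e : L → (Fin 3 → Fin (2 + 1)))
    (he : Function.Injective e) (hinf : ∀ x y, e (x ⊓ y) = e x ⊓ e y) (hsup : ∀ x y, e (x ⊔ y) = e x ⊔ e y)
    {μ : L → ℝ} (hμ : IsFKGMeasure μ) : SahiPositive μ n :=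
  sahiPositive_of_latticeEmbedding_grid ((liebSahi_grid_iff_uniform 3 n).2 hU) e he hinf hsup hμ

/-- **`[2]×[2]×[3]` lies in layer three**: under `U(3,n)`, every FKG probability weight on `Fin 2 × Fin 2 × Fin 3` is
Sahi-positive at order `n` (embedding `(a,b,c) ↦ (a,b,c)` into `[3]³`). [this work] -/
theorem sahiPositive_prod223_of_uniform (hU : ∀ M, 0 < M → SahiPositive (fun _ : Fin 3 → Fin M => (1 : ℝ) / (M : ℝ) ^ 3) n)
    {μ : Fin 2 × Fin 2 × Fin 3 → ℝ} (hμ : IsFKGMeasure μ) : SahiPositive μ n :=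
  sahiPositive_of_embedding_box3 hU
    (fun x : Fin 2 × Fin 2 × Fin 3 => ![Fin.castSucc x.1, Fin.castSucc x.2.1, x.2.2])
    (by decide) (by decide) (by decide) hμ

/-- **`V+pt = WithBot(2²)×2` lies in layer three**: under `U(3,n)`, every FKG probability weight on
`WithBot (Fin 2 × Fin 2) × Fin 2` is Sahi-positive at order `n` (embedding `⊥ ↦ (0,0)`, `(a,b) ↦ (a+1,b+1)` on the first
block). [this work] -/
theorem sahiPositive_withBotSqTwo_of_uniform
    (hU : ∀ M, 0 < M → SahiPositive (fun _ : Fin 3 → Fin M => (1 : ℝ) / (M : ℝ) ^ 3) n)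
    {μ : WithBot (Fin 2 × Fin 2) × Fin 2 → ℝ} (hμ : IsFKGMeasure μ) : SahiPositive μ n :=
  sahiPositive_of_embedding_box3 hU
    (fun x : WithBot (Fin 2 × Fin 2) × Fin 2 =>
      WithBot.recBotCoe ![0, 0, Fin.castSucc x.2] (fun p => ![Fin.succ p.1, Fin.succ p.2, Fin.castSucc x.2]) x.1)
    (by decide) (by decide) (by decide) hμ

/-- **`Λ+pt = WithTop(2²)×2` lies in layer three**: under `U(3,n)`, every FKG probability weight on
`WithTop (Fin 2 × Fin 2) × Fin 2` is Sahi-positive at order `n` (embedding `(a,b) ↦ (a,b)`, `⊤ ↦ (2,2)` on the first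
block). [this work] -/
theorem sahiPositive_withTopSqTwo_of_uniform
    (hU : ∀ M, 0 < M → SahiPositive (fun _ : Fin 3 → Fin M => (1 : ℝ) / (M : ℝ) ^ 3) n)
    {μ : WithTop (Fin 2 × Fin 2) × Fin 2 → ℝ} (hμ : IsFKGMeasure μ) : SahiPositive μ n :=
  sahiPositive_of_embedding_box3 hU
    (fun x : WithTop (Fin 2 × Fin 2) × Fin 2 =>
      WithTop.recTopCoe ![2, 2, Fin.castSucc x.2] (fun p => ![Fin.castSucc p.1, Fin.castSucc p.2, Fin.castSucc x.2]) x.1)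
    (by decide) (by decide) (by decide) hμ

end

end Summit.CriticalPhenomena.PercolationContinuityZ3.Theorems.SahiWidth
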